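/-
Copyright: the b2b-balaban T⁴-continuum CRUX team, row NE7b OWNER lineage `t4-ne7b-p1` (gen 119). Project licence.
-/
import Mathlib.MeasureTheory.Group.Integral
import Summits.QuantumFields.BalabanUV.T4Continuum.Spine.NE7b.SupConvexFibreIntegral

/-!
# THE LAPLACE SANDWICH: THE INTEGRATED AND THE MINIMISED EFFECTIVE ACTIONS DIFFER BY A FIELD-INDEPENDENT CONSTANT WINDOW — for
# `S` in (110)'s class (modulus `m > 0`), a block map `Qt` with right inverse `M`, a chart `P` of `ker Qt` (`p·Σ z² ≤ Σ(P z)²`) and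
# the fibre minimiser `Φ` of (110), `∫ e^{−S(M w + P z)} dz ≤ e^{−S(Φ w)}·(2π∕(m p))^{|σ|∕2}` at EVERY `w`; on the two-sided class
# (upper modulus `Λ`, `P` ONTO `ker Qt` with `Σ(P z)² ≤ p′·Σ z²`) also `e^{−S(Φ w)}·(2π∕(Λ p′))^{|σ|∕2} ≤ ∫ e^{−S(M w + P z)} dz`; so
# `W_int − W_min` lies in a window of width `½|σ|·log(Λp′∕(mp))` that does not depend on the block field: the saddle point is exact
# up to the logarithm of the condition number (row NE7b, node U5c; (115) + (93) BY NAME; [folklore])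

Cell `pub-balaban`, sub-cell `t4`, spine estimate NE7b (`T4WeightBudget.RelWeightBound`; the cell's OWN estimate — NOT PRINTED in
[Bałaban 1983–89], NOT PROVED).  Crux-route work under `Spine/NE7b/` by the row OWNER (`t4-ne7b-p1` gen 119) under FREEZE (0)'s
crux-prover clause, on the OWNER g118's located NEXT item (3)(c) «the measure side: the Laplace bound `W_true ≥ W − (dim∕2)log(2π∕m)`»;
NOTHING of Bałaban's is named as a Lean object, valued or asserted; no `T4Continuum/Support` leaf typed; no `def`, no notation; zero
`sorry`.  Imports (BY NAME): the OWNER's (115) `…SupConvexFibreIntegral` (`integrable_exp_neg_chart`, `integrable_gaussian_pi`; through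
it (114) `continuous_of_hasFDerivAt`, (93) `exists_isMinOn_of_firstOrder`), Mathlib's Gaussian integral, `MeasureTheory.Integral.Pi` and
the translation invariance of the product Lebesgue measure.

WHY (located).  (110) iterates the MINIMISING step `W_min = S∘Φ`, (116) the INTEGRATED step `W_int = −log ∫ e^{−S(M w + P z)} dz`;
print's renormalisation group compares the two at every scale («the background field dominates the fluctuation integral»).  On the
class the comparison is elementary and uniform in the block field: the letter at the minimiser `z⋆` of `z ↦ S(M w + P z)` (which
exists and is critical, modulus `m·p`) gives `S(M w + P z) ≥ S(Φ w) + ½(mp)Σ(z − z⋆)²`, a Gaussian majorant of the density centred at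
`z⋆`; the upper letter at the FIBRE-critical `Φ w` (whose gradient kills `ker Qt ∋ M w + P z − Φ w = P(z + z₀)`) gives
`S(M w + P z) ≤ S(Φ w) + ½(Λp′)Σ(z + z₀)²`, a Gaussian minorant; both integrate in closed form by Fubini on `σ → ℝ` and translation
invariance, `∫ e^{−aΣ(z_i − c_i)²} dz = (π∕a)^{|σ|∕2}`.

WHAT IS PROVED ([folklore]; finite carriers `ι, κ, σ`):
* §1 `exp_neg_sum_sq_eq_prod`, **`integral_gaussian_pi_shift`** (`∫ e^{−aΣ(z_i − c_i)²} dz = (√(π∕a))^{|σ|}` on `σ → ℝ`),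
  `integrable_gaussian_pi_shift`.
* §2 (the first-order class, `m > 0`; `Qt∘M = 1`, `Qt∘P = 0`, `p·Σ z² ≤ Σ(P z)²`, `p > 0`; `Φ w` minimises `S` on the fibre `{Qt ψ = w}`)
  `exists_chart_minimiser` (a minimiser `z⋆` of `z ↦ S(M w + P z)` with `S(M w + P z⋆) + ½(mp)Σ(z − z⋆)² ≤ S(M w + P z)`),
  **`fibreIntegral_le_laplace`** (`∫ e^{−S(M w + P z)} dz ≤ e^{−S(Φ w)}·(√(2π∕(mp)))^{|σ|}`), **`fibreMin_le_negLog_fibreIntegral`**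
  (`S(Φ w) − |σ|·log √(2π∕(mp)) ≤ W_int(w)` — the located Laplace lower bound).
* §3 (the two-sided class, `Λ > 0`; `Φ` fibre-critical with `Qt(Φ w) = w`; `P` onto `ker Qt`, `Σ(P z)² ≤ p′Σ z²`, `p′ > 0`)
  **`laplace_le_fibreIntegral`** (`e^{−S(Φ w)}·(√(2π∕(Λp′)))^{|σ|} ≤ ∫ e^{−S(M w + P z)} dz`), **`negLog_fibreIntegral_le_fibreMin`**
  (`W_int(w) ≤ S(Φ w) − |σ|·log √(2π∕(Λp′))`).
* §4 **`increment_sandwich`** (for all `w, w′`: the increments of `W_int` and of `W_min = S∘Φ` differ by at most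
  `|σ|·(log √(2π∕(mp)) − log √(2π∕(Λp′))) = ½|σ|·log(Λp′∕(mp))`, a constant independent of `w, w′`).
* §5 toy.

HONEST (what this is NOT).  Closed-form Gaussian comparison on the class; the width grows with the number `|σ|` of integrated
directions (it is the naive bound, not the cumulant expansion print uses to get volume-uniform errors per unit volume — that needs
locality, not claimed); two-sided class for the upper half (`φ⁴` excluded); `Φ` is taken as a hypothesis in (110)'s letters
(`step_closure` supplies it); nothing about which block maps ∕ charts print uses; cubic periods; scalar skeleton, hard constraint
((A3), NC-NE7b-α UNRULED); nothing of Bałaban's.  BY-NAME EFFECT ON THE WALL: NONE.  NE7b NOT PRINTED ∕ NOT PROVED; spine PROVED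
0∕9; rung (B)+1 on a FINITE torus — NOT infinite volume, NOT the mass gap, NOT Clay.  HONEST DEPENDENCY: continuum YM on T⁴ ⇐
BetaPertH ∧ nine spine estimates (0∕9 proved); BetaPertH ⇐ (D1) ∧ (D4) ∧ CAP+tail; G-an2-4 gates asym, D1 and NE2∕3∕4.
-/

set_option autoImplicit false

noncomputable section

namespace Summit.QuantumFields.BalabanUV.T4Continuum.NE7b.SupConvexStepLaplace

open Set Function Filter Metric MeasureTheory Real
open scoped Topology
open SupTorusActionMinimiser (exists_isMinOn_of_firstOrder)
open SupConvexClassEnvelope (continuous_of_hasFDerivAt)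
open SupConvexFibreIntegral (integrable_exp_neg_chart fibreIntegral_pos integrable_gaussian_pi)

/-! ## §1. Gaussian integrals on a finite carrier -/

section Gaussian

variable {σ : Type*} [Fintype σ]

/-- `e^{−aΣ_i (z_i − c_i)²} = Π_i e^{−a(z_i − c_i)²}`. [folklore] -/
theorem exp_neg_sum_sq_eq_prod (a : ℝ) (z c : σ → ℝ) :
    exp (-a * ∑ i, (z i - c i) ^ 2) = ∏ i, exp (-a * (z i - c i) ^ 2) := by
  rw [Finset.mul_sum, Real.exp_sum]

/-- **THE SHIFTED PRODUCT GAUSSIAN INTEGRATES IN CLOSED FORM**: `∫ e^{−aΣ(z_i − c_i)²} dz = (√(π∕a))^{|σ|}` for the product Lebesgue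
measure on `σ → ℝ` (translation invariance, Fubini, the one-dimensional Gaussian integral; for `a ≤ 0` both sides are the junk
value, as in Mathlib's `integral_gaussian`). [folklore] -/
theorem integral_gaussian_pi_shift (a : ℝ) (c : σ → ℝ) :
    ∫ z : σ → ℝ, exp (-a * ∑ i, (z i - c i) ^ 2) = (√(π / a)) ^ Fintype.card σ := by
  have hshift : ∫ z : σ → ℝ, exp (-a * ∑ i, (z i - c i) ^ 2) = ∫ z : σ → ℝ, exp (-a * ∑ i, z i ^ 2) := by
    have := integral_sub_right_eq_self (μ := (volume : Measure (σ → ℝ))) (fun z : σ → ℝ => exp (-a * ∑ i, z i ^ 2)) c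
    simpa only [Pi.sub_apply] using this
  rw [hshift]
  have hprod : (fun z : σ → ℝ => exp (-a * ∑ i, z i ^ 2)) = fun z => ∏ i, exp (-a * z i ^ 2) := by
    funext z; rw [Finset.mul_sum, Real.exp_sum]
  rw [hprod, integral_fintype_prod_volume_eq_pow (fun t : ℝ => exp (-a * t ^ 2)), integral_gaussian]

/-- The shifted product Gaussian (times a constant) is integrable. [folklore] -/
theorem integrable_gaussian_pi_shift {a : ℝ} (ha : 0 < a) (C : ℝ) (c : σ → ℝ) :
    Integrable (fun z : σ → ℝ => C * exp (-a * ∑ i, (z i - c i) ^ 2)) := by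
  have h := (integrable_gaussian_pi (σ := σ) ha C).comp_sub_right c
  simpa only [Pi.sub_apply] using h

end Gaussian

/-! ## §2. The Laplace lower bound: the integrated action is at least the minimum, minus `|σ|·log √(2π∕(mp))` -/

section Lower

variable {ι κ σ : Type*} [Fintype ι] [Fintype κ] [Fintype σ]
  {S : (ι → ℝ) → ℝ} {S' : (ι → ℝ) → (ι → ℝ) →L[ℝ] ℝ} {m p : ℝ}
  (Qt : (ι → ℝ) →L[ℝ] (κ → ℝ)) (M : (κ → ℝ) →L[ℝ] (ι → ℝ)) (P : (σ → ℝ) →L[ℝ] (ι → ℝ))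

omit [Fintype κ] in
/-- **THE ACTION ALONG THE CHART HAS A CRITICAL MINIMISER WITH MODULUS `m·p`**: `z ↦ S(M w + P z)` attains its minimum at some `z⋆`,
the chart gradient `(S′(M w + P z⋆))∘P` vanishes there, and `S(M w + P z⋆) + ½(mp)·Σ(z − z⋆)² ≤ S(M w + P z)` for every `z`. [folklore] -/
theorem exists_chart_minimiser (hS : ∀ φ, HasFDerivAt S (S' φ) φ)
    (hlo : ∀ φ ψ : ι → ℝ, S φ + S' φ (ψ - φ) + m / 2 * ∑ x, (ψ x - φ x) ^ 2 ≤ S ψ) (hm : 0 < m)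
    (hP : ∀ z : σ → ℝ, p * ∑ i, z i ^ 2 ≤ ∑ x, P z x ^ 2) (hp : 0 < p) (w : κ → ℝ) :
    ∃ zs : σ → ℝ, (S' (M w + P zs)).comp P = 0 ∧
      ∀ z : σ → ℝ, S (M w + P zs) + m * p / 2 * ∑ i, (z i - zs i) ^ 2 ≤ S (M w + P z) := by
  have hcont : Continuous S := continuous_of_hasFDerivAt hS
  -- the chart letter with modulus `m·p`
  have hchart : ∀ z₀ z : σ → ℝ,
      S (M w + P z₀) + ((S' (M w + P z₀)).comp P) (z - z₀) + m * p / 2 * ∑ i, (z i - z₀ i) ^ 2 ≤ S (M w + P z) := by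
    intro z₀ z
    have h := hlo (M w + P z₀) (M w + P z)
    have e : M w + P z - (M w + P z₀) = P (z - z₀) := by rw [map_sub]; abel
    rw [e] at h
    have e2 : ∑ x, ((M w + P z) x - (M w + P z₀) x) ^ 2 = ∑ x, (P (z - z₀)) x ^ 2 :=
      Finset.sum_congr rfl fun x _ => by
        have := congr_fun e x
        simp only [Pi.sub_apply, Pi.add_apply] at this ⊢
        rw [this]
    rw [e2] at h
    have hPz := hP (z - z₀)
    simp only [Pi.sub_apply] at hPz
    have := mul_le_mul_of_nonneg_left hPz (by positivity : 0 ≤ m / 2)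
    rw [ContinuousLinearMap.comp_apply]
    linarith
  have hg : Continuous fun z : σ → ℝ => S (M w + P z) := hcont.comp ((continuous_const (y := M w)).add P.continuous)
  obtain ⟨zs, -, hmin⟩ := exists_isMinOn_of_firstOrder (S := fun z : σ → ℝ => S (M w + P z)) hg isClosed_univ
    (mem_univ (0 : σ → ℝ)) (L := (S' (M w + P 0)).comp P) (m := m * p) (mul_pos hm hp) fun z _ => hchart 0 z
  have hd : HasFDerivAt (fun z : σ → ℝ => S (M w + P z)) ((S' (M w + P zs)).comp P) zs :=
    (hS (M w + P zs)).comp zs (P.hasFDerivAt.const_add (M w))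
  have hcrit : (S' (M w + P zs)).comp P = 0 := (hmin.isLocalMin univ_mem).hasFDerivAt_eq_zero hd
  refine ⟨zs, hcrit, fun z => ?_⟩
  have h := hchart zs z
  rw [hcrit, zero_apply, add_zero] at h
  exact h

omit [Fintype κ] in
/-- **THE LAPLACE MAJORANT**: with `Qt∘M = 1`, `Qt∘P = 0` and `Φ w` minimising `S` on the fibre `{Qt ψ = w}`,
`∫ e^{−S(M w + P z)} dz ≤ e^{−S(Φ w)}·(√(2π∕(mp)))^{|σ|}`. [folklore] -/
theorem fibreIntegral_le_laplace (hS : ∀ φ, HasFDerivAt S (S' φ) φ)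
    (hlo : ∀ φ ψ : ι → ℝ, S φ + S' φ (ψ - φ) + m / 2 * ∑ x, (ψ x - φ x) ^ 2 ≤ S ψ) (hm : 0 < m)
    (hQM : ∀ k : κ → ℝ, Qt (M k) = k) (hQP : ∀ z : σ → ℝ, Qt (P z) = 0)
    (hP : ∀ z : σ → ℝ, p * ∑ i, z i ^ 2 ≤ ∑ x, P z x ^ 2) (hp : 0 < p)
    {Φ : (κ → ℝ) → (ι → ℝ)} (hΦmin : ∀ w, IsMinOn S {ψ | Qt ψ = w} (Φ w)) (w : κ → ℝ) :
    ∫ z : σ → ℝ, exp (-S (M w + P z)) ≤ exp (-S (Φ w)) * (√(2 * π / (m * p))) ^ Fintype.card σ := by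
  obtain ⟨zs, -, hzs⟩ := exists_chart_minimiser M P hS hlo hm hP hp w
  have hfib : S (Φ w) ≤ S (M w + P zs) :=
    isMinOn_iff.1 (hΦmin w) (M w + P zs) (show Qt (M w + P zs) = w by rw [map_add, hQM, hQP, add_zero])
  have hpt : ∀ z : σ → ℝ, exp (-S (M w + P z)) ≤ exp (-S (Φ w)) * exp (-(m * p / 2) * ∑ i, (z i - zs i) ^ 2) := by
    intro z
    rw [← exp_add]
    exact exp_le_exp.2 (by linarith [hzs z])
  have hmp : 0 < m * p / 2 := by positivity
  calc ∫ z : σ → ℝ, exp (-S (M w + P z))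
      ≤ ∫ z : σ → ℝ, exp (-S (Φ w)) * exp (-(m * p / 2) * ∑ i, (z i - zs i) ^ 2) :=
        integral_mono (integrable_exp_neg_chart M P hS hlo hm hP hp w) (integrable_gaussian_pi_shift hmp _ zs) hpt
    _ = exp (-S (Φ w)) * (√(2 * π / (m * p))) ^ Fintype.card σ := by
        rw [integral_const_mul, integral_gaussian_pi_shift (m * p / 2) zs]
        congr 3
        field_simp

omit [Fintype κ] in
/-- **THE LAPLACE LOWER BOUND FOR THE INTEGRATED EFFECTIVE ACTION**: `S(Φ w) − |σ|·log √(2π∕(mp)) ≤ −log ∫ e^{−S(M w + P z)} dz` — the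
integrated action is at least the minimised one, minus a constant per integrated direction. [folklore] -/
theorem fibreMin_le_negLog_fibreIntegral (hS : ∀ φ, HasFDerivAt S (S' φ) φ)
    (hlo : ∀ φ ψ : ι → ℝ, S φ + S' φ (ψ - φ) + m / 2 * ∑ x, (ψ x - φ x) ^ 2 ≤ S ψ) (hm : 0 < m)
    (hQM : ∀ k : κ → ℝ, Qt (M k) = k) (hQP : ∀ z : σ → ℝ, Qt (P z) = 0)
    (hP : ∀ z : σ → ℝ, p * ∑ i, z i ^ 2 ≤ ∑ x, P z x ^ 2) (hp : 0 < p)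
    {Φ : (κ → ℝ) → (ι → ℝ)} (hΦmin : ∀ w, IsMinOn S {ψ | Qt ψ = w} (Φ w)) (w : κ → ℝ) :
    S (Φ w) - Fintype.card σ * log (√(2 * π / (m * p))) ≤ -log (∫ z : σ → ℝ, exp (-S (M w + P z))) := by
  have hZ := fibreIntegral_pos M P hS hlo hm hP hp w
  have hsq : 0 < √(2 * π / (m * p)) := sqrt_pos.2 (by positivity)
  have h := log_le_log hZ (fibreIntegral_le_laplace Qt M P hS hlo hm hQM hQP hP hp hΦmin w)
  rw [log_mul (exp_pos _).ne' (pow_pos hsq _).ne', log_exp, log_pow] at h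
  linarith

end Lower

/-! ## §3. The Laplace upper bound (two-sided class, chart onto the fibre) -/

section Upper

variable {ι κ σ : Type*} [Fintype ι] [Fintype κ] [Fintype σ]
  {S : (ι → ℝ) → ℝ} {S' : (ι → ℝ) → (ι → ℝ) →L[ℝ] ℝ} {m Λ p p' : ℝ}
  (Qt : (ι → ℝ) →L[ℝ] (κ → ℝ)) (M : (κ → ℝ) →L[ℝ] (ι → ℝ)) (P : (σ → ℝ) →L[ℝ] (ι → ℝ))

omit [Fintype κ] in
/-- **THE LAPLACE MINORANT** (two-sided class, `Λ > 0`; `Φ` fibre-critical with `Qt(Φ w) = w`; `P` onto `ker Qt` with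
`Σ(P z)² ≤ p′Σ z²`, `p′ > 0`): `e^{−S(Φ w)}·(√(2π∕(Λp′)))^{|σ|} ≤ ∫ e^{−S(M w + P z)} dz`. [folklore] -/
theorem laplace_le_fibreIntegral (hS : ∀ φ, HasFDerivAt S (S' φ) φ)
    (hlo : ∀ φ ψ : ι → ℝ, S φ + S' φ (ψ - φ) + m / 2 * ∑ x, (ψ x - φ x) ^ 2 ≤ S ψ) (hm : 0 < m)
    (hup : ∀ φ ψ : ι → ℝ, S ψ ≤ S φ + S' φ (ψ - φ) + Λ / 2 * ∑ x, (ψ x - φ x) ^ 2) (hΛ : 0 < Λ)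
    (hQM : ∀ k : κ → ℝ, Qt (M k) = k) (hQP : ∀ z : σ → ℝ, Qt (P z) = 0)
    (hP : ∀ z : σ → ℝ, p * ∑ i, z i ^ 2 ≤ ∑ x, P z x ^ 2) (hp : 0 < p)
    (hPsurj : ∀ h : ι → ℝ, Qt h = 0 → ∃ z : σ → ℝ, P z = h) (hP' : ∀ z : σ → ℝ, ∑ x, P z x ^ 2 ≤ p' * ∑ i, z i ^ 2)
    (hp' : 0 < p') {Φ : (κ → ℝ) → (ι → ℝ)} (hΦQ : ∀ w, Qt (Φ w) = w)
    (hΦcrit : ∀ (w : κ → ℝ) (h : ι → ℝ), Qt h = 0 → S' (Φ w) h = 0) (w : κ → ℝ) :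
    exp (-S (Φ w)) * (√(2 * π / (Λ * p'))) ^ Fintype.card σ ≤ ∫ z : σ → ℝ, exp (-S (M w + P z)) := by
  -- `M w − Φ w ∈ ker Qt = range P`
  obtain ⟨z₀, hz₀⟩ := hPsurj (M w - Φ w) (by rw [map_sub, hQM, hΦQ, sub_self])
  have hpt : ∀ z : σ → ℝ, exp (-S (Φ w)) * exp (-(Λ * p' / 2) * ∑ i, (z i - (-z₀) i) ^ 2) ≤ exp (-S (M w + P z)) := by
    intro z
    rw [← exp_add]
    refine exp_le_exp.2 ?_
    have h := hup (Φ w) (M w + P z)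
    have e : M w + P z - Φ w = P (z + z₀) := by rw [map_add, hz₀]; abel
    have hkill : S' (Φ w) (M w + P z - Φ w) = 0 := hΦcrit w _ (by rw [e, hQP])
    rw [hkill, add_zero] at h
    have e2 : ∑ x, ((M w + P z) x - Φ w x) ^ 2 = ∑ x, (P (z + z₀)) x ^ 2 :=
      Finset.sum_congr rfl fun x _ => by
        have := congr_fun e x
        simp only [Pi.sub_apply, Pi.add_apply] at this ⊢
        rw [this]
    rw [e2] at h
    have hPz := hP' (z + z₀)
    have e3 : ∑ i, (z i - (-z₀) i) ^ 2 = ∑ i, (z + z₀) i ^ 2 :=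
      Finset.sum_congr rfl fun i _ => by simp only [Pi.neg_apply, Pi.add_apply, sub_neg_eq_add]
    rw [e3]
    have := mul_le_mul_of_nonneg_left hPz (by positivity : 0 ≤ Λ / 2)
    linarith
  have hΛp : 0 < Λ * p' / 2 := by positivity
  calc exp (-S (Φ w)) * (√(2 * π / (Λ * p'))) ^ Fintype.card σ
      = ∫ z : σ → ℝ, exp (-S (Φ w)) * exp (-(Λ * p' / 2) * ∑ i, (z i - (-z₀) i) ^ 2) := by
        rw [integral_const_mul, integral_gaussian_pi_shift (Λ * p' / 2) (-z₀)]
        congr 3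
        field_simp
    _ ≤ ∫ z : σ → ℝ, exp (-S (M w + P z)) :=
        integral_mono (integrable_gaussian_pi_shift hΛp _ _) (integrable_exp_neg_chart M P hS hlo hm hP hp w) hpt

omit [Fintype κ] in
/-- **THE LAPLACE UPPER BOUND FOR THE INTEGRATED EFFECTIVE ACTION**: under the hypotheses of `laplace_le_fibreIntegral`,
`−log ∫ e^{−S(M w + P z)} dz ≤ S(Φ w) − |σ|·log √(2π∕(Λp′))`. [folklore] -/
theorem negLog_fibreIntegral_le_fibreMin (hS : ∀ φ, HasFDerivAt S (S' φ) φ)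
    (hlo : ∀ φ ψ : ι → ℝ, S φ + S' φ (ψ - φ) + m / 2 * ∑ x, (ψ x - φ x) ^ 2 ≤ S ψ) (hm : 0 < m)
    (hup : ∀ φ ψ : ι → ℝ, S ψ ≤ S φ + S' φ (ψ - φ) + Λ / 2 * ∑ x, (ψ x - φ x) ^ 2) (hΛ : 0 < Λ)
    (hQM : ∀ k : κ → ℝ, Qt (M k) = k) (hQP : ∀ z : σ → ℝ, Qt (P z) = 0)
    (hP : ∀ z : σ → ℝ, p * ∑ i, z i ^ 2 ≤ ∑ x, P z x ^ 2) (hp : 0 < p)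
    (hPsurj : ∀ h : ι → ℝ, Qt h = 0 → ∃ z : σ → ℝ, P z = h) (hP' : ∀ z : σ → ℝ, ∑ x, P z x ^ 2 ≤ p' * ∑ i, z i ^ 2)
    (hp' : 0 < p') {Φ : (κ → ℝ) → (ι → ℝ)} (hΦQ : ∀ w, Qt (Φ w) = w)
    (hΦcrit : ∀ (w : κ → ℝ) (h : ι → ℝ), Qt h = 0 → S' (Φ w) h = 0) (w : κ → ℝ) :
    -log (∫ z : σ → ℝ, exp (-S (M w + P z))) ≤ S (Φ w) - Fintype.card σ * log (√(2 * π / (Λ * p'))) := by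
  have hsq : 0 < √(2 * π / (Λ * p')) := sqrt_pos.2 (by positivity)
  have hlow : 0 < exp (-S (Φ w)) * (√(2 * π / (Λ * p'))) ^ Fintype.card σ := mul_pos (exp_pos _) (pow_pos hsq _)
  have h := log_le_log hlow
    (laplace_le_fibreIntegral Qt M P hS hlo hm hup hΛ hQM hQP hP hp hPsurj hP' hp' hΦQ hΦcrit w)
  rw [log_mul (exp_pos _).ne' (pow_pos hsq _).ne', log_exp, log_pow] at h
  linarith

end Upper

/-! ## §4. The increments of the two effective actions agree up to a field-independent window -/

section Sandwich

variable {ι κ σ : Type*} [Fintype ι] [Fintype κ] [Fintype σ]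
  {S : (ι → ℝ) → ℝ} {S' : (ι → ℝ) → (ι → ℝ) →L[ℝ] ℝ} {m Λ p p' : ℝ}
  (Qt : (ι → ℝ) →L[ℝ] (κ → ℝ)) (M : (κ → ℝ) →L[ℝ] (ι → ℝ)) (P : (σ → ℝ) →L[ℝ] (ι → ℝ))

omit [Fintype κ] in
/-- **THE INCREMENT SANDWICH**: on the two-sided class, with `Φ` the fibre-critical minimiser of (110) (`Qt(Φ w) = w`, `S′(Φ w)` kills
`ker Qt`, `Φ w` minimises on its fibre) and `P` a chart ONTO `ker Qt` (`p·Σ z² ≤ Σ(P z)² ≤ p′·Σ z²`), for ALL block fields `w, w′`: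
`|(W_int w′ − W_int w) − (S(Φ w′) − S(Φ w))| ≤ |σ|·(log √(2π∕(mp)) − log √(2π∕(Λp′)))` (`= ½|σ|·log(Λp′∕(mp))`) — the integrated and
the minimised effective actions have the same increments up to a constant that does not depend on the fields. [folklore] -/
theorem increment_sandwich (hS : ∀ φ, HasFDerivAt S (S' φ) φ)
    (hlo : ∀ φ ψ : ι → ℝ, S φ + S' φ (ψ - φ) + m / 2 * ∑ x, (ψ x - φ x) ^ 2 ≤ S ψ) (hm : 0 < m)
    (hup : ∀ φ ψ : ι → ℝ, S ψ ≤ S φ + S' φ (ψ - φ) + Λ / 2 * ∑ x, (ψ x - φ x) ^ 2) (hΛ : 0 < Λ)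
    (hQM : ∀ k : κ → ℝ, Qt (M k) = k) (hQP : ∀ z : σ → ℝ, Qt (P z) = 0)
    (hP : ∀ z : σ → ℝ, p * ∑ i, z i ^ 2 ≤ ∑ x, P z x ^ 2) (hp : 0 < p)
    (hPsurj : ∀ h : ι → ℝ, Qt h = 0 → ∃ z : σ → ℝ, P z = h) (hP' : ∀ z : σ → ℝ, ∑ x, P z x ^ 2 ≤ p' * ∑ i, z i ^ 2)
    (hp' : 0 < p') {Φ : (κ → ℝ) → (ι → ℝ)} (hΦQ : ∀ w, Qt (Φ w) = w)
    (hΦcrit : ∀ (w : κ → ℝ) (h : ι → ℝ), Qt h = 0 → S' (Φ w) h = 0) (hΦmin : ∀ w, IsMinOn S {ψ | Qt ψ = w} (Φ w))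
    (w w' : κ → ℝ) :
    |(-log (∫ z : σ → ℝ, exp (-S (M w' + P z))) - -log (∫ z : σ → ℝ, exp (-S (M w + P z)))) - (S (Φ w') - S (Φ w))| ≤
      Fintype.card σ * (log (√(2 * π / (m * p))) - log (√(2 * π / (Λ * p')))) := by
  have l1 := fibreMin_le_negLog_fibreIntegral Qt M P hS hlo hm hQM hQP hP hp hΦmin w
  have l2 := fibreMin_le_negLog_fibreIntegral Qt M P hS hlo hm hQM hQP hP hp hΦmin w'
  have u1 := negLog_fibreIntegral_le_fibreMin Qt M P hS hlo hm hup hΛ hQM hQP hP hp hPsurj hP' hp' hΦQ hΦcrit w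
  have u2 := negLog_fibreIntegral_le_fibreMin Qt M P hS hlo hm hup hΛ hQM hQP hP hp hPsurj hP' hp' hΦQ hΦcrit w'
  rw [abs_le]
  constructor <;> nlinarith

end Sandwich

/-! ## §5. Toy -/

/-- Toy (§1 with one integrated direction, `a = 1`, centre `c`): `∫ e^{−Σ(z − c)²} dz = √π`. -/
example (c : Unit → ℝ) : ∫ z : Unit → ℝ, exp (-1 * ∑ i, (z i - c i) ^ 2) = (√(π / 1)) ^ Fintype.card Unit :=
  integral_gaussian_pi_shift 1 c

end Summit.QuantumFields.BalabanUV.T4Continuum.NE7b.SupConvexStepLaplace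

end
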